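import Summits.KontsevichZagierPeriods.Zeta5Search.Certificates.RecordRayPartnerSeries
import HarnessLib

/-!
# ζ(5) search — certificates: the dual series at the partner point `b′` — II: partial sums and the rate (cell `pub-zeta5`, cert-2 g2)

HONEST FRAMING: systematic search; no irrationality claim unless certified.

OUR work (Summit side; certifier 2, generation 2). Continuation of `Certificates/RecordRayPartnerSeries.lean`
(`T̂(B′,μ)(19n+1)(19n) = T̂(B,μ)(11n+μ+1)(30n+μ+1)`, `Z(B′) = Z(B)(19n+1)(19n)`, fourth-power tail from `μ ≥ 3n`):

* `termHat_weighted_tail` — `μ ≥ 3n ⇒ T̂(μ)(11n+μ+1)(30n+μ+1) ≤ 52·W_n(3n+1)⁴/(μ+1)²` (`n ≥ 100`);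
* `partial_sums_partner_le` — `Σ_{μ<N} T̂(B,μ)(11n+μ+1)(30n+μ+1) ≤ W_n·((3n+1)(14n+1)(33n+1) + 52(3n+1)³)`;
* `vwpDual_record'_upper` — `F̃₇(bRecord' n) ≤ Z_n·W_n·((3n+1)(14n+1)(33n+1) + 52(3n+1)³)` (`n ≥ 100`);
* `eventually_vwpDual_record'_le_exp` — **for every `ε > 0`, eventually `F̃₇(bRecord' n) ≤ Z_n·e^{(−125.5308+ε)n}`**,
  the same certified rate as `F̃₇(bRecord n)` (`RecordRayDualSeriesFinal`), `Z_n = termNorm (41n) (Brec n)`.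
-/

noncomputable section

open Finset Real Filter Topology

namespace Summit.KontsevichZagierPeriods.Zeta5Search.RecordRay

open Summit.KontsevichZagierPeriods.Zeta5Search.DualSeries
open Summit.KontsevichZagierPeriods.Zeta5Search.DualSeriesBounds
open Summit.KontsevichZagierPeriods.Zeta5Search.DualSeriesLemma19 (bRecord)
open Summit.KontsevichZagierPeriods.Zeta5Search.RecordLine (BrecE BrecE_zero bRecord'_eq hreg_recE)
open Literature.NumberTheory.Irrationality.BrownZudilin2022 (vwpDual)

/-- **Weighted tail**: for `μ ≥ 3n` (`n ≥ 100`), `T̂(μ)·(11n+μ+1)(30n+μ+1) ≤ 52·W_n·(3n+1)⁴/(μ+1)²`. -/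
theorem termHat_weighted_tail {n μ : ℕ} (hn : 100 ≤ n) (hμ : 3 * n ≤ μ) :
    termHat (41 * n) (Brec n) μ * ((11 * (n : ℝ) + μ + 1) * (30 * n + μ + 1)) ≤
      52 * Wn n * (3 * (n : ℝ) + 1) ^ 4 / ((μ : ℝ) + 1) ^ 2 := by
  have h := termHat_le_of_tail4 (B₀ := 41 * n) (B := Brec n) (μ₃ := 3 * n) (fun ν hν => termHat_rec_tail4 hν) hμ
  have hW := termHat_le_W hn (3 * n)
  have hμR : (3 : ℝ) * n ≤ μ := by exact_mod_cast hμ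
  have hμ1 : (0 : ℝ) < (μ : ℝ) + 1 := by positivity
  have hp : (11 * (n : ℝ) + μ + 1) * (30 * n + μ + 1) ≤ 52 * ((μ : ℝ) + 1) ^ 2 := by nlinarith
  have hT0 : 0 ≤ termHat (41 * n) (Brec n) μ := (termHat_pos (B₀ := 41 * n) (hreg_rec n) μ).le
  have hW0 : 0 ≤ Wn n := (Real.exp_pos _).le
  have h4 : 0 ≤ ((((3 * n : ℕ) : ℝ) + 1) / ((μ : ℝ) + 1)) ^ 4 := by positivity
  calc termHat (41 * n) (Brec n) μ * ((11 * (n : ℝ) + μ + 1) * (30 * n + μ + 1))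
      ≤ (termHat (41 * n) (Brec n) (3 * n) * ((((3 * n : ℕ) : ℝ) + 1) / ((μ : ℝ) + 1)) ^ 4) *
          (52 * ((μ : ℝ) + 1) ^ 2) :=
        mul_le_mul h hp (by positivity) (mul_nonneg (termHat_pos (B₀ := 41 * n) (hreg_rec n) (3 * n)).le h4)
    _ ≤ (Wn n * ((((3 * n : ℕ) : ℝ) + 1) / ((μ : ℝ) + 1)) ^ 4) * (52 * ((μ : ℝ) + 1) ^ 2) :=
          mul_le_mul_of_nonneg_right (mul_le_mul_of_nonneg_right hW h4) (by positivity)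
    _ = 52 * Wn n * (3 * (n : ℝ) + 1) ^ 4 / ((μ : ℝ) + 1) ^ 2 := by
          push_cast
          field_simp

/-- **Weighted partial sums**: `Σ_{μ<N} T̂(μ)(11n+μ+1)(30n+μ+1) ≤ W_n·((3n+1)(14n+1)(33n+1) + 52(3n+1)³)` (`n ≥ 100`). -/
theorem partial_sums_partner_le {n : ℕ} (hn : 100 ≤ n) (N : ℕ) :
    ∑ μ ∈ range N, termHat (41 * n) (Brec n) μ * ((11 * (n : ℝ) + μ + 1) * (30 * n + μ + 1)) ≤
      Wn n * ((3 * (n : ℝ) + 1) * (14 * n + 1) * (33 * n + 1) + 52 * (3 * (n : ℝ) + 1) ^ 3) := by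
  have hW0 : 0 ≤ Wn n := (Real.exp_pos _).le
  have hT0 : ∀ μ, 0 ≤ termHat (41 * n) (Brec n) μ := fun μ => (termHat_pos (B₀ := 41 * n) (hreg_rec n) μ).le
  have hn0 : (0 : ℝ) ≤ n := Nat.cast_nonneg n
  -- head terms
  have head : ∀ μ, μ ≤ 3 * n → termHat (41 * n) (Brec n) μ * ((11 * (n : ℝ) + μ + 1) * (30 * n + μ + 1)) ≤
      Wn n * ((14 * (n : ℝ) + 1) * (33 * n + 1)) := by
    intro μ hμ
    have hμR : (μ : ℝ) ≤ 3 * n := by exact_mod_cast hμ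
    have hμ0 : (0 : ℝ) ≤ μ := Nat.cast_nonneg μ
    apply mul_le_mul (termHat_le_W hn μ) _ (by positivity) hW0
    nlinarith
  have headsum : ∀ N, N ≤ 3 * n + 1 →
      ∑ μ ∈ range N, termHat (41 * n) (Brec n) μ * ((11 * (n : ℝ) + μ + 1) * (30 * n + μ + 1)) ≤
        Wn n * ((3 * (n : ℝ) + 1) * (14 * n + 1) * (33 * n + 1)) := by
    intro N hN
    calc ∑ μ ∈ range N, termHat (41 * n) (Brec n) μ * ((11 * (n : ℝ) + μ + 1) * (30 * n + μ + 1))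
        ≤ ∑ _μ ∈ range N, Wn n * ((14 * (n : ℝ) + 1) * (33 * n + 1)) :=
          sum_le_sum fun μ hμ => head μ (by have := mem_range.1 hμ; omega)
      _ = N * (Wn n * ((14 * (n : ℝ) + 1) * (33 * n + 1))) := by rw [sum_const, card_range, nsmul_eq_mul]
      _ ≤ (3 * (n : ℝ) + 1) * (Wn n * ((14 * (n : ℝ) + 1) * (33 * n + 1))) := by
          have : (N : ℝ) ≤ 3 * n + 1 := by exact_mod_cast hN
          exact mul_le_mul_of_nonneg_right this (by positivity)
      _ = Wn n * ((3 * (n : ℝ) + 1) * (14 * n + 1) * (33 * n + 1)) := by ring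
  have hpos3 : 0 ≤ 52 * (3 * (n : ℝ) + 1) ^ 3 := by positivity
  rcases le_or_gt N (3 * n + 1) with hN | hN
  · have := headsum N hN
    nlinarith
  · -- tail by telescoping induction from 3n+1
    have key : ∀ N, 3 * n + 1 ≤ N →
        ∑ μ ∈ range N, termHat (41 * n) (Brec n) μ * ((11 * (n : ℝ) + μ + 1) * (30 * n + μ + 1)) ≤
          Wn n * ((3 * (n : ℝ) + 1) * (14 * n + 1) * (33 * n + 1)) +
            52 * Wn n * (3 * (n : ℝ) + 1) ^ 4 * (1 / (3 * (n : ℝ) + 1) - 1 / (N : ℝ)) := by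
      intro N hN
      induction N, hN using Nat.le_induction with
      | base =>
        have h1 := headsum (3 * n + 1) le_rfl
        have h2 : (1 / (3 * (n : ℝ) + 1) - 1 / ((3 * n + 1 : ℕ) : ℝ)) = 0 := by push_cast; ring
        rw [h2]; linarith
      | succ N hN ih =>
        rw [sum_range_succ]
        have hNpos : (0 : ℝ) < N := by exact_mod_cast (show 0 < N by omega)
        have ht := termHat_weighted_tail hn (show 3 * n ≤ N by omega)
        have hsq : 1 / ((N : ℝ) + 1) ^ 2 ≤ 1 / (N : ℝ) - 1 / ((N : ℝ) + 1) := by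
          have e : 1 / (N : ℝ) - 1 / ((N : ℝ) + 1) = 1 / ((N : ℝ) * ((N : ℝ) + 1)) := by field_simp; ring
          rw [e]
          apply div_le_div_of_nonneg_left zero_le_one (by positivity)
          nlinarith
        have hstep : termHat (41 * n) (Brec n) N * ((11 * (n : ℝ) + N + 1) * (30 * n + N + 1)) ≤
            52 * Wn n * (3 * (n : ℝ) + 1) ^ 4 * (1 / (N : ℝ) - 1 / ((N : ℝ) + 1)) := by
          calc termHat (41 * n) (Brec n) N * ((11 * (n : ℝ) + N + 1) * (30 * n + N + 1))
              ≤ 52 * Wn n * (3 * (n : ℝ) + 1) ^ 4 / ((N : ℝ) + 1) ^ 2 := ht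
            _ = 52 * Wn n * (3 * (n : ℝ) + 1) ^ 4 * (1 / ((N : ℝ) + 1) ^ 2) := by ring
            _ ≤ 52 * Wn n * (3 * (n : ℝ) + 1) ^ 4 * (1 / (N : ℝ) - 1 / ((N : ℝ) + 1)) :=
                mul_le_mul_of_nonneg_left hsq (by positivity)
        have hc : ((N + 1 : ℕ) : ℝ) = (N : ℝ) + 1 := by push_cast; ring
        rw [hc]
        linarith
    have h := key N hN.le
    have hNpos : (0 : ℝ) < N := by exact_mod_cast (show 0 < N by omega)
    have hinv : 0 ≤ 1 / (N : ℝ) := by positivity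
    have h3n : (0 : ℝ) < 3 * (n : ℝ) + 1 := by positivity
    have e : 52 * Wn n * (3 * (n : ℝ) + 1) ^ 4 * (1 / (3 * (n : ℝ) + 1)) = Wn n * (52 * (3 * (n : ℝ) + 1) ^ 3) := by
      field_simp
    nlinarith [mul_nonneg (mul_nonneg (mul_nonneg (by norm_num : (0:ℝ) ≤ 52) hW0) (pow_nonneg h3n.le 4)) hinv]

/-! ### The partner dual series -/

/-- **Upper bound**: `F̃₇(bRecord' n) ≤ Z_n·W_n·((3n+1)(14n+1)(33n+1) + 52(3n+1)³)` (`n ≥ 100`, `Z_n` the RECORD normaliser). -/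
theorem vwpDual_record'_upper {n : ℕ} (hn : 100 ≤ n) :
    vwpDual 7 (bRecord' n) ≤ termNorm (41 * n) (Brec n) *
      (Wn n * ((3 * (n : ℝ) + 1) * (14 * n + 1) * (33 * n + 1) + 52 * (3 * (n : ℝ) + 1) ^ 3)) := by
  have hn1 : 1 ≤ n := by omega
  have hq : (0 : ℝ) < (19 * (n : ℝ) + 1) * (19 * n) := by
    have : (1 : ℝ) ≤ n := by exact_mod_cast hn1
    exact mul_pos (by linarith) (by linarith)
  set S' : ℝ := Wn n * ((3 * (n : ℝ) + 1) * (14 * n + 1) * (33 * n + 1) + 52 * (3 * (n : ℝ) + 1) ^ 3) with hS'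
  have hS : ∀ N, ∑ μ ∈ range N, termHat (41 * n) (BrecE 1 n) μ ≤ S' / ((19 * (n : ℝ) + 1) * (19 * n)) := by
    intro N
    rw [le_div_iff₀ hq, sum_mul]
    calc ∑ μ ∈ range N, termHat (41 * n) (BrecE 1 n) μ * ((19 * (n : ℝ) + 1) * (19 * n))
        = ∑ μ ∈ range N, termHat (41 * n) (Brec n) μ * ((11 * (n : ℝ) + μ + 1) * (30 * n + μ + 1)) :=
          sum_congr rfl fun μ _ => termHat_partner_mul hn1 μ
      _ ≤ S' := partial_sums_partner_le hn N
  have h := vwpDual_seven_le_of_partial_sums (hle_rec' hn1) (hreg_recE le_rfl hn1) (hs_rec' n) hS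
  rw [bRecord'_eq, termNorm_partner hn1] at *
  calc vwpDual 7 (natB (41 * n) (BrecE 1 n))
      ≤ termNorm (41 * n) (Brec n) * ((19 * (n : ℝ) + 1) * (19 * n)) * (S' / ((19 * (n : ℝ) + 1) * (19 * n))) := h
    _ = termNorm (41 * n) (Brec n) * S' := by field_simp

/-- **Rate of the partner dual series**: for every `ε > 0`, eventually `F̃₇(bRecord' n) ≤ Z_n·e^{(−125.5308 + ε)·n}`. -/
theorem eventually_vwpDual_record'_le_exp {ε : ℝ} (hε : 0 < ε) :
    ∀ᶠ n : ℕ in atTop, vwpDual 7 (bRecord' n) ≤ termNorm (41 * n) (Brec n) * Real.exp ((-1255308 / 10000 + ε) * n) := by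
  filter_upwards [eventually_ge_atTop 100,
    eventually_log_linear_le (a := 42) (b := 0) (by norm_num) le_rfl (show (0 : ℝ) < ε / 400 by positivity),
    eventually_log_linear_le (a := 43) (b := 4) (by norm_num) (by norm_num) (show (0 : ℝ) < ε / 40 by positivity),
    tendsto_natCast_atTop_atTop.eventually_ge_atTop (500 / ε)] with n hn h42 h43 hbig
  refine (vwpDual_record'_upper hn).trans (mul_le_mul_of_nonneg_left ?_ (termNorm_pos _ _).le)
  have hn' : (100 : ℝ) ≤ n := by exact_mod_cast hn
  -- the polynomial factor is ≤ (43n+4)^4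
  have hP : (3 * (n : ℝ) + 1) * (14 * n + 1) * (33 * n + 1) + 52 * (3 * (n : ℝ) + 1) ^ 3 ≤ (43 * (n : ℝ) + 4) ^ 4 := by
    nlinarith [sq_nonneg ((n : ℝ)), mul_pos (show (0:ℝ) < n by linarith) (show (0:ℝ) < n by linarith)]
  have hP' : (3 * (n : ℝ) + 1) * (14 * n + 1) * (33 * n + 1) + 52 * (3 * (n : ℝ) + 1) ^ 3 ≤
      Real.exp (4 * Real.log (43 * n + 4)) := by
    rw [show (4 : ℝ) * Real.log (43 * n + 4) = Real.log ((43 * n + 4) ^ 4) by rw [Real.log_pow]; norm_num,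
      Real.exp_log (by positivity)]
    exact hP
  have hW : Wn n = Real.exp ((n : ℝ) * (hhat04 + lambdaPlus / 20) + 2 * lambdaPlus + 96 * (1 + Real.log (42 * n))
      + 9 / 2 * Real.log (43 * n + 4) + 14) := rfl
  have hWP : Wn n * ((3 * (n : ℝ) + 1) * (14 * n + 1) * (33 * n + 1) + 52 * (3 * (n : ℝ) + 1) ^ 3) ≤
      Real.exp (((n : ℝ) * (hhat04 + lambdaPlus / 20) + 2 * lambdaPlus + 96 * (1 + Real.log (42 * n))
      + 9 / 2 * Real.log (43 * n + 4) + 14) + 4 * Real.log (43 * n + 4)) := by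
    rw [Real.exp_add, hW]
    exact mul_le_mul_of_nonneg_left hP' (Real.exp_pos _).le
  refine hWP.trans (Real.exp_le_exp.mpr ?_)
  have hh := hhat04_le
  obtain ⟨lp0, lp1⟩ := lambdaPlus_bounds
  have hn0 : (0 : ℝ) ≤ n := Nat.cast_nonneg n
  rw [add_zero] at h42
  have hc : (500 : ℝ) ≤ ε * n := by rwa [div_le_iff₀ hε, mul_comm] at hbig
  have hlog43 : 0 ≤ Real.log (43 * (n : ℝ) + 4) := Real.log_nonneg (by linarith)
  nlinarith

end Summit.KontsevichZagierPeriods.Zeta5Search.RecordRay
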